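import Summits.ABC.IUTFork.Joshi.TestDictionaryCalibrationPlaces
import Summits.ABC.IUTFork.Thm311RealDH
import HarnessLib

/-!
# Branch E TEST vs S — the calibration across places, X: the place obstruction at the GENUINE log-shells `⊗_{i≤j} ⊕_{v|v_ℚ} K_v`

Record file of the abc-iut cell, branch E (rung LADDER-ABC:A2.E; seat abc-iut-E-t42 gen 3; sequel of
`Joshi/TestDictionaryCalibrationPlaces.lean` p438822 and `…PlacesAll.lean` p443073). **No side is taken** on [IUTchIII] Cor. 3.12 or
on any author (Mochizuki / Scholze–Stix / Joshi / Dupuy–Hilado); typed ≠ proved; located, not adjudicated.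

THE POINT. Parts II–IX of the X-10 suite decide the SIGN of the structural hypothesis `IndPlaceSeparable` — under which X-01's
one-indeterminacy hypothesis set ⟺ `UniformIndRelated` ⟺ S := `PilotKummerIndRelated` (part II
`dictionaryRealizable_iff_pilotKummerIndRelated_of_separable`) — only at the two-place TOY index with `ℚ²` carriers
(`TwoPlace.not_indPlaceSeparable_anyIsm`, p443073); at the GENUINE index of [IUTchIII] Thm. 3.11 (abc-iut-c312-5's
`Thm311.Real.thetaIndex X`: `V = V(F)`, `V_ℚ = V(ℚ)`, packets `⊗_{i ∈ S^±_{j+1}} ⊕_{v | v_ℚ} K_v` over `ℚ`, `Thm311.Real.logShells`) only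
the (Ind1)-only FORM of the hypothesis was available (part IX p443742), not its sign. THIS FILE decides it, for EVERY reading of the two
automorphism slots (proof-only apart from ONE index-free test shape, §1):
* §1 `AnyIndex.IsMonomial` + **`AnyIndex.exists_isMonomial_of_mem_closure`** — over EVERY signature `L : LogShells T` every member of
  `⟨(Ind1) ∪ (Ind2)⟩` is `permute σ_j * factorwise g` at every packet `(j, v_ℚ)`, with ONE capsule permutation `σ_j` per label for ALL
  places (closure induction over abc-iut-c312's wreath algebra `Thm311SigProofs`; part VII's argument freed from the toy index);
* §2 **`AnyIndex.eq_one_of_permute_eq_factorwise`** — FAITHFULNESS over any 1-tensor packet carrying two `ℚ`-linearly independent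
  vectors: `permute σ = factorwise g ⟹ σ = 1` (two pure-tensor tests read through product functionals `prodFun`; the functionals come
  from Mathlib's `LinearMap.exists_extend_of_notMem`, no coordinates needed);
* §3 **`AnyIndex.not_indPlaceSeparable_of_two_places`** — any signature with two distinct places whose 1-tensor packets both have
  `ℚ`-rank `≥ 2` is NOT place-separable (witness: the capsule swap `(0 j)` at the top label at one place, the identity at the other);
* §4 **`Genuine.not_indPlaceSeparable_logShells`** — at `Thm311.Real.logShells X logv Aut Ism` for EVERY number field `F` with
  `[F : ℚ] ≥ 2` (so for every field of initial Θ-data: [IUTchI] Def. 3.1 (a) «`F` is a number field such that `√−1 ∈ F`»,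
  `Literature.IUT.HodgeTheaters.InitialThetaData.sqrt_neg_one_mem`; `Genuine.one_lt_finrank_of_sqrt_neg_one`), every `PilotData X`,
  every family of `p_v`-adic logarithms `logv` and EVERY choice of the strip-automorphism slot `Aut` and the Ism slot `Ism` — hence for
  the Dupuy–Hilado instance `Real.logShellsDH` (`Genuine.not_indPlaceSeparable_logShellsDH`) and for the M-level binders alike:
  `⟨(Ind1) ∪ (Ind2)⟩` on the genuine tensor packets is NOT place-separable (places `∞ ≠ 2`; `K_v ⊇ F ⊋ ℚ·1` at every `v`).
So the located sentence of the suite — «S as typed is PACKET-LOCAL; the one-indeterminacy (print-shaped, [IUTchIII] Thm. 3.11 (i)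
p. 154 «the indeterminacies induced by the automorphisms of the procession of 𝒟⊢-prime-strips» = ONE permutation of `S^±_{j+1}` for all
`v_ℚ`) forms are S-OR-STRONGER, and the sufficient condition `IndPlaceSeparable` for ⟺ fails» — now holds AT THE GENUINE CARRIERS of
Theorem 3.11, whatever Ism is; no FILLS / COUNTERMODEL verdict changes (every one-place and every (Ind)-trivial model of record keeps
its ⟺, parts II/V). Located, not adjudicated. [claim: Mochizuki2012, status: disputed] [claim: Joshi2024ATS3, status: disputed]
[cite: DupuyHilado2025, §4.7, §4.9] [cite: ScholzeStix2018, §2.2 pp. 9–10]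
-/

noncomputable section

open Set

namespace Summit.ABC.IUTFork.Joshi

open Thm311 Cor312 Cor312Vol Literature.IUT.LogThetaLattice

namespace AnyIndex

variable {T : ThetaIndex} (L : LogShells T)

/-! ## 1. The monomial form at ANY index: one capsule permutation per label, for all places -/

/-- **`AnyIndex.IsMonomial L Φ σ`** — at every packet `(j, v_ℚ)`, `Φ_{j,v_ℚ} = permute σ_j * factorwise g` for some family `g` of
automorphisms of the 1-tensor packet: the PERMUTATION PART `σ_j` is the same at every place (part VII's `TwoPlace.IsMonomial`, over an
arbitrary signature). TEST SHAPE on automorphism families, never asserted; no author claims it. [claim: Mochizuki2012, status: disputed] -/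
@[claim "Mochizuki2012" "disputed"]
def IsMonomial (Φ : L.PacketAut) (σ : ∀ j : T.Label, Equiv.Perm (T.Caps j)) : Prop :=
  ∀ (j : T.Label) (vQ : T.VQ), ∃ g : T.Caps j → (L.Packet1 vQ ≃ₗ[ℚ] L.Packet1 vQ),
    Φ j vQ = L.permute j vQ (σ j) * L.factorwise j vQ g

variable {L}

/-- The identity is monomial along `1`. [folklore] -/
theorem isMonomial_one : IsMonomial L 1 1 := fun j vQ =>
  ⟨1, by rw [L.factorwise_one, mul_one]; exact (L.permute_refl j vQ).symm⟩

/-- Products of monomial families are monomial along the product of the permutation parts. [folklore] -/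
theorem IsMonomial.mul {Φ Ψ : L.PacketAut} {σ τ : ∀ j : T.Label, Equiv.Perm (T.Caps j)}
    (hΦ : IsMonomial L Φ σ) (hΨ : IsMonomial L Ψ τ) : IsMonomial L (Φ * Ψ) (σ * τ) := fun j vQ => by
  obtain ⟨g, hg⟩ := hΦ j vQ
  obtain ⟨h, hh⟩ := hΨ j vQ
  refine ⟨(fun i => g ((τ j) i)) * h, ?_⟩
  rw [Pi.mul_apply, Pi.mul_apply, hg, hh, Pi.mul_apply, L.permute_mul, L.factorwise_mul, mul_assoc,
    ← mul_assoc (L.factorwise j vQ g), L.factorwise_mul_permute, mul_assoc, mul_assoc]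

/-- Inverses of monomial families are monomial along the inverse permutation parts. [folklore] -/
theorem IsMonomial.inv {Φ : L.PacketAut} {σ : ∀ j : T.Label, Equiv.Perm (T.Caps j)} (hΦ : IsMonomial L Φ σ) :
    IsMonomial L Φ⁻¹ σ⁻¹ := fun j vQ => by
  obtain ⟨g, hg⟩ := hΦ j vQ
  refine ⟨fun i => g⁻¹ ((σ j)⁻¹ i), ?_⟩
  rw [Pi.inv_apply, Pi.inv_apply, hg, mul_inv_rev, ← L.factorwise_inv, ← L.permute_inv, L.factorwise_mul_permute, Pi.inv_apply]

/-- An (Ind2)-family is monomial along `1` (it IS factorwise — at every index). [claim: Mochizuki2012, status: disputed] -/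
theorem isMonomial_of_mem_Ind2Family {Φ : L.PacketAut} (hΦ : Φ ∈ L.Ind2Family) : IsMonomial L Φ 1 := fun j vQ => by
  obtain ⟨g, -, hΦj⟩ := hΦ j vQ
  refine ⟨fun i => L.summandwise vQ (g i), ?_⟩
  rw [hΦj, Pi.one_apply, show L.permute j vQ (1 : Equiv.Perm (T.Caps j)) = 1 from L.permute_refl j vQ, one_mul]

/-- An (Ind1)-family is monomial along ITS capsule permutations `(σ_j)_j` — one per label for ALL places (the frozen `LogShells.Ind1`:
«ONE permutation `σ` for every `v_ℚ`», [IUTchIII] Thm. 3.11 (i) p. 154). [claim: Mochizuki2012, status: disputed] -/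
theorem exists_isMonomial_of_mem_Ind1Family {Φ : L.PacketAut} (hΦ : Φ ∈ L.Ind1Family) : ∃ σ, IsMonomial L Φ σ := by
  choose σ h hh hΦj using hΦ
  refine ⟨σ, fun j vQ => ⟨fun i => L.summandwise vQ fun v => h j ((σ j) i) v.1, ?_⟩⟩
  rw [show Φ j vQ = _ from hΦj j vQ, ← LinearEquiv.mul_eq_trans, L.factorwise_mul_permute]

/-- **`AnyIndex.exists_isMonomial_of_mem_closure`** — over EVERY signature (any index, any carriers, any strip-automorphism and Ism
slots), every element of `⟨(Ind1) ∪ (Ind2)⟩` has the monomial form with ONE capsule permutation per label for all places.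
[claim: Mochizuki2012, status: disputed] -/
theorem exists_isMonomial_of_mem_closure {Φ : L.PacketAut} (hΦ : Φ ∈ Subgroup.closure (L.Ind1Family ∪ L.Ind2Family)) :
    ∃ σ, IsMonomial L Φ σ := by
  induction hΦ using Subgroup.closure_induction with
  | mem Φ hΦ =>
    rcases hΦ with h1 | h2
    · exact exists_isMonomial_of_mem_Ind1Family h1
    · exact ⟨1, isMonomial_of_mem_Ind2Family h2⟩
  | one => exact ⟨1, isMonomial_one⟩
  | mul Φ Ψ _ _ ihΦ ihΨ =>
    obtain ⟨σ, hσ⟩ := ihΦ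
    obtain ⟨τ, hτ⟩ := ihΨ
    exact ⟨σ * τ, hσ.mul hτ⟩
  | inv Φ _ ih =>
    obtain ⟨σ, hσ⟩ := ih
    exact ⟨σ⁻¹, hσ.inv⟩

/-! ## 2. Faithfulness over any 1-tensor packet of `ℚ`-rank `≥ 2` -/

section Functionals

variable {M : Type*} [AddCommGroup M] [Module ℚ M]

/-- Every nonzero vector of a `ℚ`-vector space admits a functional taking the value `1` on it. [folklore] -/
theorem exists_functional_eq_one {y : M} (hy : y ≠ 0) : ∃ ψ : M →ₗ[ℚ] ℚ, ψ y = 1 := by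
  have hy' : y ∉ (⊥ : Submodule ℚ M) := by rwa [Submodule.mem_bot]
  obtain ⟨g, -, hg⟩ := LinearMap.exists_extend_of_notMem (0 : (⊥ : Submodule ℚ M) →ₗ[ℚ] ℚ) hy' 1
  exact ⟨g, hg⟩

/-- A `ℚ`-linearly independent pair `(e₀, e₁)` admits functionals `φ₀`, `φ₁` with `φ₀ e₀ = 1`, `φ₀ e₁ = 0`, `φ₁ e₁ = 1`. [folklore] -/
theorem exists_functionals_of_linearIndependent {e₀ e₁ : M} (h : LinearIndependent ℚ ![e₀, e₁]) :
    ∃ φ₀ φ₁ : M →ₗ[ℚ] ℚ, φ₀ e₀ = 1 ∧ φ₀ e₁ = 0 ∧ φ₁ e₁ = 1 := by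
  have h₁ : e₁ ≠ 0 := fun h0 => by
    have := (LinearIndependent.pair_iff.1 h 0 1 (by rw [zero_smul, one_smul, zero_add, h0])).2
    exact one_ne_zero this
  have h₀ : e₀ ∉ (ℚ ∙ e₁ : Submodule ℚ M) := fun hmem => by
    obtain ⟨a, ha⟩ := Submodule.mem_span_singleton.1 hmem
    have := (LinearIndependent.pair_iff.1 h 1 (-a) (by rw [one_smul, neg_smul, ha, add_neg_cancel])).1
    exact one_ne_zero this
  obtain ⟨φ₀, hφ₀, h00⟩ := LinearMap.exists_extend_of_notMem (0 : (ℚ ∙ e₁ : Submodule ℚ M) →ₗ[ℚ] ℚ) h₀ 1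
  obtain ⟨φ₁, h11⟩ := exists_functional_eq_one h₁
  refine ⟨φ₀, φ₁, h00, ?_, h11⟩
  have := LinearMap.congr_fun hφ₀ ⟨e₁, Submodule.mem_span_singleton_self e₁⟩
  rwa [LinearMap.comp_apply, Submodule.subtype_apply, LinearMap.zero_apply] at this

end Functionals

variable (L)

/-- The product functional `⊗_k y_k ↦ ∏_k φ_k(y_k)` of a family of linear functionals on the factors of a tensor packet. [folklore] -/
def prodFun {j : T.Label} (vQ : T.VQ) (φ : T.Caps j → (L.Packet1 vQ →ₗ[ℚ] ℚ)) : L.Packet j vQ →ₗ[ℚ] ℚ :=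
  (PiTensorProduct.constantBaseRingEquiv (T.Caps j) ℚ).toLinearEquiv.toLinearMap ∘ₗ PiTensorProduct.map φ

/-- The product functional on a pure tensor. [folklore] -/
theorem prodFun_tprod {j : T.Label} (vQ : T.VQ) (φ : T.Caps j → (L.Packet1 vQ →ₗ[ℚ] ℚ)) (x : T.Caps j → L.Packet1 vQ) :
    prodFun L vQ φ (L.tprod j vQ x) = ∏ k, φ k (x k) := by
  unfold prodFun LogShells.tprod
  rw [LinearMap.comp_apply]
  erw [PiTensorProduct.map_tprod]
  change (PiTensorProduct.constantBaseRingEquiv (T.Caps j) ℚ) (PiTensorProduct.tprod ℚ fun k : T.Caps j => φ k (x k)) = _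
  rw [PiTensorProduct.constantBaseRingEquiv_tprod]

/-- `factorwise` on a pure tensor (any signature). [folklore] -/
theorem factorwise_tprod {j : T.Label} (vQ : T.VQ) (g : T.Caps j → (L.Packet1 vQ ≃ₗ[ℚ] L.Packet1 vQ))
    (x : T.Caps j → L.Packet1 vQ) :
    L.factorwise j vQ g (L.tprod j vQ x) = L.tprod j vQ fun k => g k (x k) :=
  PiTensorProduct.congr_tprod g x

/-- **`AnyIndex.eq_one_of_permute_eq_factorwise` — FAITHFULNESS**: on a 1-tensor packet carrying a `ℚ`-linearly independent pair
`(e₀, e₁)`, a capsule permutation that coincides with a factorwise automorphism is the identity. Proof (part VII's, coordinate-free): if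
`σ k₀ = k₁ ≠ k₀`, test on `e₁ ⊗ ⋯ ⊗ e₁` (fixed by `permute σ`, whence `φ₀ (g_{k₁} e₁) = 0` through a product functional adapted to the
nonzero `g_k e₁`) and on the pattern «`e₀` at `k₀`, `e₁` elsewhere» (moved to «`e₀` at `k₁`», which the factorwise side cannot produce:
its `k₁`-factor is `g_{k₁} e₁`). [folklore] -/
theorem eq_one_of_permute_eq_factorwise {j : T.Label} {vQ : T.VQ} {e₀ e₁ : L.Packet1 vQ} (he : LinearIndependent ℚ ![e₀, e₁])
    {σ : Equiv.Perm (T.Caps j)} {g : T.Caps j → (L.Packet1 vQ ≃ₗ[ℚ] L.Packet1 vQ)}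
    (h : L.permute j vQ σ = L.factorwise j vQ g) : σ = 1 := by
  classical
  by_contra hσ
  obtain ⟨k₀, hk₀⟩ : ∃ k₀, σ k₀ ≠ k₀ :=
    not_forall.1 fun hall => hσ (Equiv.ext fun x => (hall x).trans (Equiv.Perm.one_apply x).symm)
  set k₁ := σ k₀ with hk₁
  obtain ⟨φ₀, φ₁, h00, h01, h11⟩ := exists_functionals_of_linearIndependent he
  have he₁ : e₁ ≠ 0 := fun h0 => by rw [h0, map_zero] at h11; exact zero_ne_one h11
  -- Step A: `φ₀ (g_{k₁} e₁) = 0` (test on `e₁ ⊗ ⋯ ⊗ e₁`).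
  have hA0 : ∀ k, g k e₁ ≠ 0 := fun k h0 => he₁ ((g k).injective (h0.trans (map_zero (g k)).symm))
  choose ψ hψ using fun k => exists_functional_eq_one (hA0 k)
  have hempty : L.tprod j vQ (fun k => g k e₁) = L.tprod j vQ (fun _ => e₁) := by
    have h1 := congrArg (fun Φ : L.Packet j vQ ≃ₗ[ℚ] L.Packet j vQ => Φ (L.tprod j vQ fun _ => e₁)) h
    rw [L.permute_tprod, factorwise_tprod] at h1
    exact h1.symm
  have hcoord : φ₀ (g k₁ e₁) = 0 := by
    let Ψ : T.Caps j → (L.Packet1 vQ →ₗ[ℚ] ℚ) := fun k => if k = k₁ then φ₀ else ψ k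
    have h1 := congrArg (prodFun L vQ Ψ) hempty
    rw [prodFun_tprod, prodFun_tprod, Finset.prod_eq_single k₁ (fun k _ hk => by simp only [Ψ, if_neg hk]; exact hψ k)
      (fun hk => absurd (Finset.mem_univ k₁) hk)] at h1
    have hΨ : Ψ k₁ = φ₀ := if_pos rfl
    rw [hΨ] at h1
    rw [h1]
    exact Finset.prod_eq_zero (Finset.mem_univ k₁) (by rw [hΨ]; exact h01)
  -- Step B: the pattern «`e₀` at `k₀`, `e₁` elsewhere», read through «`φ₀` at `k₁`, `φ₁` elsewhere».
  let x : T.Caps j → L.Packet1 vQ := fun k => if k = k₀ then e₀ else e₁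
  let Δ : T.Caps j → (L.Packet1 vQ →ₗ[ℚ] ℚ) := fun k => if k = k₁ then φ₀ else φ₁
  have hL : prodFun L vQ Δ (L.permute j vQ σ (L.tprod j vQ x)) = 1 := by
    rw [L.permute_tprod, prodFun_tprod]
    refine Finset.prod_eq_one fun k _ => ?_
    by_cases hk : k = k₁
    · have hΔ : Δ k = φ₀ := if_pos hk
      have hx : x (σ.symm k) = e₀ := by
        rw [hk, hk₁, Equiv.symm_apply_apply]; exact if_pos rfl
      rw [hΔ, hx]; exact h00
    · have hΔ : Δ k = φ₁ := if_neg hk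
      have hx : x (σ.symm k) = e₁ := by
        refine if_neg fun h' => hk ?_
        rw [hk₁, ← h', Equiv.apply_symm_apply]
      rw [hΔ, hx]; exact h11
  have hR : prodFun L vQ Δ (L.factorwise j vQ g (L.tprod j vQ x)) = 0 := by
    rw [factorwise_tprod, prodFun_tprod]
    refine Finset.prod_eq_zero (Finset.mem_univ k₁) ?_
    have hΔ : Δ k₁ = φ₀ := if_pos rfl
    have hx : x k₁ = e₁ := if_neg hk₀
    rw [hΔ, hx]; exact hcoord
  have hB := congrArg (fun Φ : L.Packet j vQ ≃ₗ[ℚ] L.Packet j vQ => prodFun L vQ Δ (Φ (L.tprod j vQ x))) h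
  rw [hL, hR] at hB
  exact one_ne_zero hB

/-! ## 3. Two places with 1-packets of rank `≥ 2` ⟹ not place-separable -/

/-- The top label `l⋇ ∈ |F_l|` (its capsule index set `S^±_{l⋇+1}` has `l⋇ + 1 ≥ 3` elements). [folklore] -/
def jTop (T : ThetaIndex) : T.Label := Fin.last T.lstar

/-- The capsule swap `(0 j)` of `S^±_{j+1}`. [folklore] -/
def sw (j : T.Label) : Equiv.Perm (T.Caps j) := Equiv.swap 0 (Fin.last _)

/-- At the top label the swap moves `0` (since `l⋇ ≥ 2 > 0`). [folklore] -/
theorem sw_jTop_apply_zero_ne : sw (jTop T) 0 ≠ 0 := by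
  intro h
  rw [sw, Equiv.swap_apply_left] at h
  have h' := congrArg Fin.val h
  simp only [jTop, Fin.val_last, Fin.val_zero] at h'
  have := T.two_le_lstar
  omega

open Classical in
/-- The PLACEWISE witness: the diagonal swap family `capsPermFamily sw` (an (Ind1)-family, part II) at the place `v_ℚ¹`, the identity at
every other place — each a member of `⟨(Ind1) ∪ (Ind2)⟩`. [folklore] -/
def placeWitness (vQ₁ vQ : T.VQ) : L.PacketAut :=
  if vQ = vQ₁ then L.capsPermFamily sw else 1

/-- Each placewise component of the witness lies in `⟨(Ind1) ∪ (Ind2)⟩`. [folklore] -/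
theorem placeWitness_mem (vQ₁ vQ : T.VQ) : placeWitness L vQ₁ vQ ∈ Subgroup.closure (L.Ind1Family ∪ L.Ind2Family) := by
  unfold placeWitness
  split_ifs
  · exact L.capsPermFamily_mem_closure sw
  · exact one_mem _

/-- At the distinguished place the witness is the swap family. [folklore] -/
theorem placeWitness_self (vQ₁ : T.VQ) : placeWitness L vQ₁ vQ₁ = L.capsPermFamily sw := by
  unfold placeWitness; exact if_pos rfl

/-- Away from the distinguished place the witness is the identity. [folklore] -/
theorem placeWitness_of_ne {vQ₀ vQ₁ : T.VQ} (hne : vQ₀ ≠ vQ₁) : placeWitness L vQ₁ vQ₀ = 1 := by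
  unfold placeWitness; exact if_neg hne

/-- **`AnyIndex.not_indPlaceSeparable_of_two_places` — THE PLACE OBSTRUCTION AT ANY INDEX**: a signature with two distinct places
`v_ℚ⁰ ≠ v_ℚ¹` whose 1-tensor packets both carry a `ℚ`-linearly independent pair is NOT place-separable, for EVERY choice of the
strip-automorphism and Ism slots: the family «identity at `v_ℚ⁰`, capsule swap at `v_ℚ¹`» is assembled place by place from members of
`⟨(Ind1) ∪ (Ind2)⟩` and is not a member — a member is monomial along ONE `σ_{l⋆}` at both places (§1); at `v_ℚ⁰` faithfulness (§2) forces
`σ_{l⋆} = 1`, at `v_ℚ¹` it then forces the swap to be `1`. [claim: Mochizuki2012, status: disputed] -/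
theorem not_indPlaceSeparable_of_two_places {vQ₀ vQ₁ : T.VQ} (hne : vQ₀ ≠ vQ₁)
    {a₀ b₀ : L.Packet1 vQ₀} (h₀ : LinearIndependent ℚ ![a₀, b₀])
    {a₁ b₁ : L.Packet1 vQ₁} (h₁ : LinearIndependent ℚ ![a₁, b₁]) : ¬ IndPlaceSeparable L := fun hsep => by
  have hmem := hsep (placeWitness L vQ₁) (placeWitness_mem L vQ₁)
  obtain ⟨σ, hσ⟩ := exists_isMonomial_of_mem_closure hmem
  -- at `v_ℚ⁰`: the component is the identity
  obtain ⟨g, hg⟩ := hσ (jTop T) vQ₀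
  change placeWitness L vQ₁ vQ₀ (jTop T) vQ₀ = _ at hg
  rw [placeWitness_of_ne L hne] at hg
  have hperm : L.permute (jTop T) vQ₀ (σ (jTop T)) = L.factorwise (jTop T) vQ₀ g⁻¹ := by
    rw [L.factorwise_inv]
    exact eq_inv_of_mul_eq_one_left hg.symm
  have hfix : σ (jTop T) = 1 := eq_one_of_permute_eq_factorwise L h₀ hperm
  -- at `v_ℚ¹`: the component is the swap
  obtain ⟨g', hg'⟩ := hσ (jTop T) vQ₁
  change placeWitness L vQ₁ vQ₁ (jTop T) vQ₁ = _ at hg'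
  rw [placeWitness_self, hfix, show L.permute (jTop T) vQ₁ (1 : Equiv.Perm (T.Caps (jTop T))) = 1 from L.permute_refl _ _,
    one_mul] at hg'
  have hsw : sw (jTop T) = 1 := eq_one_of_permute_eq_factorwise L h₁ hg'
  exact sw_jTop_apply_zero_ne (T := T) (by rw [hsw]; rfl)

end AnyIndex

/-! ## 4. The genuine log-shells of [IUTchIII] Theorem 3.11 over a number field -/

namespace Genuine

open NumberField IsDedekindDomain Literature.IUT.LogVolume Thm311.Real

variable {F : Type} [Field F] [NumberField F] (X : PilotData F) (logv : PadicLogs F)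
  (Aut Ism : ∀ x : Place F, Set (Carrier x ≃ₗ[ℚ] Carrier x))
  (hAut : ∀ x, LinearEquiv.refl ℚ (Carrier x) ∈ Aut x) (hIsm : ∀ x, LinearEquiv.refl ℚ (Carrier x) ∈ Ism x)

/-- `[F : ℚ] ≥ 2` as soon as `√−1 ∈ F` — [IUTchI] Def. 3.1 (a) «`F` is a number field such that `√−1 ∈ F`» (the field
`InitialThetaData.sqrt_neg_one_mem` of abc-iut-L5-t2's typing), since `−1` is not a square in `ℚ`. [folklore] -/
theorem one_lt_finrank_of_sqrt_neg_one (hi : ∃ i : F, i ^ 2 = -1) : 1 < Module.finrank ℚ F := by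
  obtain ⟨i, hi⟩ := hi
  by_contra hle
  have h1 : Module.finrank ℚ F = 1 := le_antisymm (not_lt.1 hle) Module.finrank_pos
  obtain ⟨c, hc⟩ := (finrank_eq_one_iff_of_nonzero' (1 : F) one_ne_zero).1 h1 i
  rw [Rat.smul_one_eq_cast] at hc
  have h2 : ((c ^ 2 : ℚ) : F) = ((-1 : ℚ) : F) := by push_cast; rw [hc, hi]
  have h3 : c ^ 2 = -1 := Rat.cast_injective h2
  nlinarith [sq_nonneg c]

/-- **Every 1-tensor packet `⊕_{v | v_ℚ} K_v` of the genuine log-shells carries a `ℚ`-linearly independent pair** when `[F : ℚ] ≥ 2`: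
`K_v ⊇ F` at some `v | v_ℚ` (the fibres are nonempty), and `F` already has two independent elements. [folklore] -/
theorem exists_linearIndependent_packet1 (hF : 1 < Module.finrank ℚ F) (vQ : RatPlace) :
    ∃ a b : (logShells X logv Aut Ism hAut hIsm).Packet1 vQ, LinearIndependent ℚ ![a, b] := by
  classical
  obtain ⟨y, hxy⟩ := exists_linearIndependent_pair_of_one_lt_finrank hF (one_ne_zero (α := F))
  obtain ⟨v₀⟩ := (inferInstance : Nonempty ((thetaIndex X).Fibre vQ))
  let ι : F →ₗ[ℚ] ((v : (thetaIndex X).Fibre vQ) → Carrier v.1) :=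
    { toFun := fun a => Pi.single v₀ (algebraMap F (Carrier v₀.1) a)
      map_add' := fun a b => by simp only [map_add, Pi.single_add]
      map_smul' := fun c a => by simp only [map_rat_smul, Pi.single_smul, RingHom.id_apply] }
  have hιa : ∀ a, ι a = Pi.single v₀ (algebraMap F (Carrier v₀.1) a) := fun a => rfl
  have hι : Function.Injective ι := fun a b hab => by
    rw [hιa, hιa] at hab
    exact (algebraMap F (Carrier v₀.1)).injective (Pi.single_injective v₀ hab)
  refine ⟨ι 1, ι y, ?_⟩
  refine LinearIndependent.pair_iff.2 fun s t hst => LinearIndependent.pair_iff.1 hxy s t (hι ?_)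
  rw [map_add, map_smul, map_smul, map_zero]
  exact hst

/-- **`Genuine.not_indPlaceSeparable_logShells` — THE PLACE OBSTRUCTION AT THE GENUINE LOG-SHELLS OF THEOREM 3.11**: for every number
field `F` with `[F : ℚ] ≥ 2`, every pilot data `X`, every family of `p_v`-adic logarithms and EVERY choice of the strip-automorphism slot
`Aut` and of the Ism slot `Ism` (each containing the identity), the indeterminacy subgroup `⟨(Ind1) ∪ (Ind2)⟩` acting on the genuine tensor
packets `⊗_{i ∈ S^±_{j+1}} ⊕_{v | v_ℚ} K_v` is NOT place-separable (§3 at the places `∞ ≠ 2`). Consequence for the suite: the sufficient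
condition under which X-01's one-indeterminacy hypothesis set ⟺ S (part II) is unavailable at the genuine carriers, for every reading of
Ism — the (Ind1) capsule permutation is one for all places there too. [claim: Mochizuki2012, status: disputed] -/
theorem not_indPlaceSeparable_logShells (hF : 1 < Module.finrank ℚ F) :
    ¬ IndPlaceSeparable (logShells X logv Aut Ism hAut hIsm) := by
  obtain ⟨a₀, b₀, h₀⟩ := exists_linearIndependent_packet1 X logv Aut Ism hAut hIsm hF (Sum.inl ())
  obtain ⟨a₁, b₁, h₁⟩ := exists_linearIndependent_packet1 X logv Aut Ism hAut hIsm hF (Sum.inr ⟨2, Nat.prime_two⟩)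
  exact AnyIndex.not_indPlaceSeparable_of_two_places _ (vQ₀ := (Sum.inl () : RatPlace))
    (vQ₁ := (Sum.inr ⟨2, Nat.prime_two⟩ : RatPlace)) Sum.inl_ne_inr h₀ h₁

/-- The same for every field of initial Θ-data (`√−1 ∈ F`, [IUTchI] Def. 3.1 (a)). [claim: Mochizuki2012, status: disputed] -/
theorem not_indPlaceSeparable_logShells_of_sqrt_neg_one (hi : ∃ i : F, i ^ 2 = -1) :
    ¬ IndPlaceSeparable (logShells X logv Aut Ism hAut hIsm) :=
  not_indPlaceSeparable_logShells X logv Aut Ism hAut hIsm (one_lt_finrank_of_sqrt_neg_one hi)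

/-- **At the Dupuy–Hilado instance `Real.logShellsDH`** (strip-automorphisms trivialised, Ism = lattice isomorphisms of the log-shell,
arXiv:2004.13228 §4.7/§4.9): not place-separable, for every `[F : ℚ] ≥ 2`, `X`, `logv`. [cite: DupuyHilado2025, §4.7, §4.9] -/
theorem not_indPlaceSeparable_logShellsDH (hF : 1 < Module.finrank ℚ F) : ¬ IndPlaceSeparable (logShellsDH X logv) :=
  not_indPlaceSeparable_logShells X logv _ _ _ _ hF

end Genuine

end Summit.ABC.IUTFork.Joshi

end
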